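import Summits.ResolutionOfSingularities.ResolutionOfSingularities.Theorems.EquisingularLiftEquisingularLiftNatDirectionCentre
import Literature.AlgebraicGeometry.Resolution.MarkedIdealsLemmas
import Literature.AlgebraicGeometry.Resolution.StalkIdealLemmas
import HarnessLib

/-!
# [OURS · L1 W4.5(b) · EL♮(3)] T-DIRLIFT part D4 — THE DIRECTION CENTRE COMMUTES WITH THE MODEL SQUARE:
# `Γ̃ · 𝒪_{G₁} = Γ̄`, the downstairs direction centre

Crux chain w45b (cell `res-hironaka`, slot W4.5(b)), working crux **EL♮** = stmt-ResolutionOfSingularities-20038, child **EL♮(3)** =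
stmt-ResolutionOfSingularities-20148, route EquisingularLift, line `sections`; supplier object **T-DIRLIFT** (plan-1 CHAIN v7.24 O2;
res-type-027 credited), part D4 (consumers: res-D-pv-029 g8's `towerRoundCech_brick`, DIR₀ `stub_elnat_dirZeroPointResolution`).
HONEST FRAMING: OURS; NOT a statement of any manuscript; AI-written, weaker than expert review. No `sorry`; standard axioms. DEF-FREE.
`--supports stmt-ResolutionOfSingularities-20148 --as helper`.

SETTING. A model square `j' ≫ τ = υ ≫ j` of blowing ups: `τ : X₁ → X` along `I` (the in-carrier curve `C`), `υ : G₁ → G` along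
`Ī = I·𝒪_G` (`j : G → X` the special fibre, say), a direction `𝒟` along `C` (`I·I ≤ 𝒟`; at the points `j z`, `z ∈ V(Ī)`, a frame
`I = (ℓ, m)` with `𝒟 = (ℓ) + (m²)` — NO quasi-regularity needed here), and the downstairs direction `𝒟̄ = 𝒟·𝒪_G` along `Ī`
(frames restrict to frames: `Ī = (ℓ̄, m̄)`, `𝒟̄ = (ℓ̄) + (m̄²)`).

WHAT.
* `isUnit_of_mul_eq_of_span_singleton_eq` — ring lemma: `q·a₁ = a₀`, `(a₁) = (a₀)`, `a₁` a non-zero-divisor ⇒ `q` is a unit.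
* `stalkMap_stalkCongr_inv_stalkMap_apply` / `stalkCongr_refl_inv_stalkMap_apply` — currency bridges for `j'♯ ∘ τ♯ = υ♯ ∘ j♯` on stalks.
* **`comap_directionCentre_eq_of_model`** — **`(controlledTransform τ I 𝒟 1).comap j' = controlledTransform υ (I.comap j) (𝒟.comap j) 1`**:
  the trace of the direction centre `Γ̃` on `G₁` IS the downstairs direction centre `Γ̄`. Stalkwise on the four chart combinations:
  on `(m, m̄)` both are `(m̄, ℓ̄/m̄)` (the fractions agree after cancelling the non-zero-divisor `m̄`); on a mixed combination the
  fraction is a unit and both are `⊤`; off `V(Ī)` both contain `𝒟̄·𝒪 = ⊤`.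

References: The Stacks Project, Tags 0804, 0805 (blow-ups and base change) — through the tree (…NatDirectionCentre p547943:
`stalkIdeal_directionCentre_of_chart_one/_zero`; T-PTPRIME p540294: `exists_chartPresentation_of_eq`, `stalkIdeal_comap_eq_span_of_chartPresentation`,
`mem_nonZeroDivisors_of_stalkIdeal_comap_eq_span`; `apply_frac_mul`; Literature `stalkIdeal_comap_eq_map_stalkMap`, `ext_of_forall_stalkIdeal_eq`,
`stalkIdeal_mul`, `comap_le_controlledTransform`; the `j'♯ ∘ τ♯` bridge adapted from F⁺5 p519966 `comap_strictTransformIdeal_eq_of_model`).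
-/

set_option linter.dupNamespace false -- mandated namespace `Summit.<Summit>.<Problem>` of this single-conjunct summit

noncomputable section

open CategoryTheory CategoryTheory.Limits AlgebraicGeometry TopologicalSpace IsLocalRing
open Literature.AlgebraicGeometry.Resolution
open AlgebraicGeometry.Scheme.IdealSheafData

namespace Summit.ResolutionOfSingularities.ResolutionOfSingularities.Cruxes.EquisingularLiftNat.Sections

universe u

/-! ## 1. A ring lemma and two currency bridges -/

/-- `q·a₁ = a₀`, `(a₁) = (a₀)` and `a₁` a non-zero-divisor force `q` to be a unit. [folklore] -/
theorem isUnit_of_mul_eq_of_span_singleton_eq {A : Type*} [CommRing A] {q a₀ a₁ : A} (hq : q * a₁ = a₀)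
    (hspan : Ideal.span {a₁} = Ideal.span {a₀}) (ha₁ : a₁ ∈ nonZeroDivisors A) : IsUnit q := by
  obtain ⟨v, hv⟩ := Ideal.mem_span_singleton'.mp (hspan ▸ Ideal.mem_span_singleton_self a₁ : a₁ ∈ Ideal.span {a₀})
  have h1 : (1 - v * q) * a₁ = 0 := by rw [sub_mul, one_mul, mul_assoc, hq, hv, sub_self]
  have h2 : v * q = 1 := (sub_eq_zero.mp ((mem_nonZeroDivisors_iff_right.mp ha₁) _ h1)).symm
  exact IsUnit.of_mul_eq_one_right v h2

variable {X X₁ G G₁ : Scheme.{u}} {τ : X₁ ⟶ X} {j : G ⟶ X} {υ : G₁ ⟶ G} {j' : G₁ ⟶ X₁}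

/-- **`j'♯ ∘ τ♯ = υ♯ ∘ j♯` on stalks** (model square `j' ≫ τ = υ ≫ j`), `τ♯` in the `stalkCongr` spelling of the chart dictionary.
[folklore; adapted from F⁺5 p519966] -/
theorem stalkMap_stalkCongr_inv_stalkMap_apply (hcomm : j' ≫ τ = υ ≫ j) (y' : G₁) (hyx : τ (j' y') = j (υ y'))
    (a : X.presheaf.stalk (j (υ y'))) :
    (j'.stalkMap y').hom (((X.presheaf.stalkCongr (.of_eq hyx)).inv ≫ τ.stalkMap (j' y')).hom a) =
      (υ.stalkMap y').hom ((j.stalkMap (υ y')).hom a) := by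
  have h1 : (j' ≫ τ).stalkMap y' = (X.presheaf.stalkCongr (.of_eq (by rw [hcomm]))).hom ≫ (υ ≫ j).stalkMap y' :=
    Scheme.Hom.stalkMap_congr_hom _ _ hcomm y'
  have h2 : ∀ z, (j'.stalkMap y').hom ((τ.stalkMap (j' y')).hom z) = ((j' ≫ τ).stalkMap y').hom z := fun z => by
    rw [Scheme.Hom.stalkMap_comp]; rfl
  have h3 : ((X.presheaf.stalkCongr (.of_eq (by rw [hcomm]) : Inseparable ((j' ≫ τ) y') ((υ ≫ j) y'))).hom)
      ((X.presheaf.stalkCongr (Inseparable.of_eq hyx)).inv a) = a := by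
    change ((X.presheaf.stalkCongr (Inseparable.of_eq hyx)).inv ≫ (X.presheaf.stalkCongr (Inseparable.of_eq hyx)).hom) a = a
    rw [Iso.inv_hom_id]; rfl
  have h4 : ∀ b, ((υ ≫ j).stalkMap y').hom b = (υ.stalkMap y').hom ((j.stalkMap (υ y')).hom b) := fun b => by
    rw [Scheme.Hom.stalkMap_comp]; rfl
  rw [CommRingCat.hom_comp, RingHom.comp_apply, h2, h1, CommRingCat.hom_comp, RingHom.comp_apply, ← h4]
  exact congrArg _ h3

/-- The `stalkCongr` spelling with `rfl`: `((stalkCongr rfl).inv ≫ υ♯) b = υ♯ b`. [folklore] -/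
theorem stalkCongr_refl_inv_stalkMap_apply (υ : G₁ ⟶ G) (y' : G₁) (b : G.presheaf.stalk (υ y')) :
    ((G.presheaf.stalkCongr (.of_eq (rfl : υ y' = υ y'))).inv ≫ υ.stalkMap y').hom b = (υ.stalkMap y').hom b := by
  rw [CommRingCat.hom_comp, RingHom.comp_apply, TopCat.Presheaf.stalkCongr_inv]
  exact congrArg _ (stalkSpecializes_self_apply G.presheaf (υ y') _ b)

/-! ## 2. The direction centre commutes with the model square -/

/-- **`Γ̃·𝒪_{G₁} = Γ̄`.** For a model square `j' ≫ τ = υ ≫ j` of blowing ups (`τ` along `I`, `υ` along `I·𝒪_G`) and a direction `𝒟`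
along `V(I)` (`I·I ≤ 𝒟`, frames `(ℓ, m)` with `𝒟 = (ℓ) + (m²)` at the points `j z`, `z ∈ V(I·𝒪_G)`):
`(controlledTransform τ I 𝒟 1)·𝒪_{G₁} = controlledTransform υ (I·𝒪_G) (𝒟·𝒪_G) 1`. [cite: StacksProject, Tag 0805] -/
theorem comap_directionCentre_eq_of_model {I : X.IdealSheafData} (hτ : IsBlowup τ I) (𝒟 : X.IdealSheafData) (hI𝒟 : I * I ≤ 𝒟)
    (hcomm : j' ≫ τ = υ ≫ j) (hυ : IsBlowup υ (I.comap j))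
    (hdir : ∀ z ∈ (I.comap j).support, ∃ c : Fin 2 → X.presheaf.stalk (j z),
      Ideal.span (Set.range c) = stalkIdeal I (j z) ∧ stalkIdeal 𝒟 (j z) = Ideal.span {c 0} ⊔ Ideal.span {c 1 * c 1}) :
    (controlledTransform τ I 𝒟 1).comap j' = controlledTransform υ (I.comap j) (𝒟.comap j) 1 := by
  refine ext_of_forall_stalkIdeal_eq fun y' => ?_
  have hyx : τ (j' y') = j (υ y') := by rw [← Scheme.Hom.comp_apply, hcomm, Scheme.Hom.comp_apply]
  rw [stalkIdeal_comap_eq_map_stalkMap]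
  by_cases hz : υ y' ∈ (I.comap j).support
  · obtain ⟨c, hc, h𝒟⟩ := hdir _ hz
    -- the restricted frame
    set cb : Fin 2 → G.presheaf.stalk (υ y') := fun i => (j.stalkMap (υ y')).hom (c i) with hcb
    have hcbI : Ideal.span (Set.range cb) = stalkIdeal (I.comap j) (υ y') := by
      rw [stalkIdeal_comap_eq_map_stalkMap, ← hc, Ideal.map_span, ← Set.range_comp]
      rfl
    have hcb𝒟 : stalkIdeal (𝒟.comap j) (υ y') = Ideal.span {cb 0} ⊔ Ideal.span {cb 1 * cb 1} := by
      rw [stalkIdeal_comap_eq_map_stalkMap, h𝒟, Ideal.map_sup, Ideal.map_span, Ideal.map_span, Set.image_singleton,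
        Set.image_singleton, map_mul]
    -- notation: `φ = j'♯`, `T = τ♯` (upstairs currency), `T' = υ♯` (downstairs currency), `a l = T' (cb l)`
    have ha : ∀ l, (j'.stalkMap y').hom (((X.presheaf.stalkCongr (.of_eq hyx)).inv ≫ τ.stalkMap (j' y')).hom (c l)) = ((G.presheaf.stalkCongr (.of_eq (rfl : υ y' = υ y'))).inv ≫ υ.stalkMap y').hom (cb l) := fun l => by
      rw [stalkMap_stalkCongr_inv_stalkMap_apply hcomm y' hyx, stalkCongr_refl_inv_stalkMap_apply]
    -- the exceptional stalk `E_{y'}` in both currencies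
    have hE : (I.comap τ).comap j' = (I.comap j).comap υ := by
      rw [← Scheme.IdealSheafData.comap_comp, ← Scheme.IdealSheafData.comap_comp, hcomm]
    have hEup : ∀ (jj : Fin 2) (χ : blowupAlgebra (Ideal.span (Set.range c)) (c jj) →+* X₁.presheaf.stalk (j' y'))
        (hχ : ∀ a, χ (algebraMap _ _ a) = ((X.presheaf.stalkCongr (.of_eq hyx)).inv ≫ τ.stalkMap (j' y')).hom a),
        stalkIdeal ((I.comap j).comap υ) y' = Ideal.span {((G.presheaf.stalkCongr (.of_eq (rfl : υ y' = υ y'))).inv ≫ υ.stalkMap y').hom (cb jj)} := fun jj χ hχ => by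
      rw [← hE, stalkIdeal_comap_eq_map_stalkMap, stalkIdeal_comap_eq_span_of_chartPresentation (j' y') hyx c hc jj χ hχ,
        Ideal.map_span, Set.image_singleton, ha]
    have hEdown : ∀ (j₁ : Fin 2) (χ' : blowupAlgebra (Ideal.span (Set.range cb)) (cb j₁) →+* G₁.presheaf.stalk y')
        (hχ' : ∀ a, χ' (algebraMap _ _ a) = ((G.presheaf.stalkCongr (.of_eq (rfl : υ y' = υ y'))).inv ≫ υ.stalkMap y').hom a),
        stalkIdeal ((I.comap j).comap υ) y' = Ideal.span {((G.presheaf.stalkCongr (.of_eq (rfl : υ y' = υ y'))).inv ≫ υ.stalkMap y').hom (cb j₁)} := fun j₁ χ' hχ' =>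
      stalkIdeal_comap_eq_span_of_chartPresentation y' rfl cb hcbI j₁ χ' hχ'
    -- fractions: `φ χ (c_l/c_jj) · a jj = a l`, `χ' (cb_l/cb_j₁) · a j₁ = a l`
    have hfrac_up : ∀ (jj l : Fin 2) (χ : blowupAlgebra (Ideal.span (Set.range c)) (c jj) →+* X₁.presheaf.stalk (j' y'))
        (hχ : ∀ a, χ (algebraMap _ _ a) = ((X.presheaf.stalkCongr (.of_eq hyx)).inv ≫ τ.stalkMap (j' y')).hom a), (j'.stalkMap y').hom (χ (blowupAlgebra.frac c jj l)) * ((G.presheaf.stalkCongr (.of_eq (rfl : υ y' = υ y'))).inv ≫ υ.stalkMap y').hom (cb jj) = ((G.presheaf.stalkCongr (.of_eq (rfl : υ y' = υ y'))).inv ≫ υ.stalkMap y').hom (cb l) := by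
      intro jj l χ hχ
      rw [← ha, ← ha, ← map_mul, apply_frac_mul c jj l χ _ hχ]
    have hfrac_down : ∀ (j₁ l : Fin 2) (χ' : blowupAlgebra (Ideal.span (Set.range cb)) (cb j₁) →+* G₁.presheaf.stalk y')
        (hχ' : ∀ a, χ' (algebraMap _ _ a) = ((G.presheaf.stalkCongr (.of_eq (rfl : υ y' = υ y'))).inv ≫ υ.stalkMap y').hom a), χ' (blowupAlgebra.frac cb j₁ l) * ((G.presheaf.stalkCongr (.of_eq (rfl : υ y' = υ y'))).inv ≫ υ.stalkMap y').hom (cb j₁) = ((G.presheaf.stalkCongr (.of_eq (rfl : υ y' = υ y'))).inv ≫ υ.stalkMap y').hom (cb l) :=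
      fun j₁ l χ' hχ' => apply_frac_mul cb j₁ l χ' _ hχ'
    -- the presentations on both floors
    have hup := exists_chartPresentation_of_eq hτ (j' y') hyx c hc
    have hdown := exists_chartPresentation_of_eq hυ y' rfl cb hcbI
    rcases Fin.exists_fin_two.mp hup with ⟨𝔔, χ, hχ, -, -⟩ | ⟨𝔔, χ, hχ, -, -⟩ <;>
      rcases Fin.exists_fin_two.mp hdown with ⟨𝔔', χ', hχ', -, -⟩ | ⟨𝔔', χ', hχ', -, -⟩
    · -- charts `(ℓ, ℓ̄)`: both `⊤`
      rw [stalkIdeal_directionCentre_of_chart_zero hτ 𝒟 (j' y') hyx c hc h𝒟 χ hχ,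
        stalkIdeal_directionCentre_of_chart_zero hυ (𝒟.comap j) y' rfl cb hcbI hcb𝒟 χ' hχ', Ideal.map_top]
    · -- charts `(ℓ, m̄)`: upstairs `⊤`; downstairs the fraction `ℓ̄/m̄` is a unit
      rw [stalkIdeal_directionCentre_of_chart_zero hτ 𝒟 (j' y') hyx c hc h𝒟 χ hχ, Ideal.map_top,
        (stalkIdeal_directionCentre_of_chart_one hυ (𝒟.comap j) y' rfl cb hcbI hcb𝒟 χ' hχ').2]
      have hspan : Ideal.span {((G.presheaf.stalkCongr (.of_eq (rfl : υ y' = υ y'))).inv ≫ υ.stalkMap y').hom (cb 1)} = Ideal.span {((G.presheaf.stalkCongr (.of_eq (rfl : υ y' = υ y'))).inv ≫ υ.stalkMap y').hom (cb 0)} := by rw [← hEdown 1 χ' hχ', hEup 0 χ hχ]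
      have hnzd : ((G.presheaf.stalkCongr (.of_eq (rfl : υ y' = υ y'))).inv ≫ υ.stalkMap y').hom (cb 1) ∈ nonZeroDivisors _ := mem_nonZeroDivisors_of_stalkIdeal_comap_eq_span hυ y' (hEdown 1 χ' hχ')
      have hunit := isUnit_of_mul_eq_of_span_singleton_eq (hfrac_down 1 0 χ' hχ') hspan hnzd
      exact (Ideal.eq_top_of_isUnit_mem _ (Ideal.mem_sup_right (Ideal.mem_span_singleton_self _)) hunit).symm
    · -- charts `(m, ℓ̄)`: downstairs `⊤`; upstairs the fraction `ℓ/m` becomes a unit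
      rw [(stalkIdeal_directionCentre_of_chart_one hτ 𝒟 (j' y') hyx c hc h𝒟 χ hχ).2,
        stalkIdeal_directionCentre_of_chart_zero hυ (𝒟.comap j) y' rfl cb hcbI hcb𝒟 χ' hχ', Ideal.map_sup, Ideal.map_span,
        Ideal.map_span, Set.image_singleton, Set.image_singleton, ha]
      have hspan : Ideal.span {((G.presheaf.stalkCongr (.of_eq (rfl : υ y' = υ y'))).inv ≫ υ.stalkMap y').hom (cb 1)} = Ideal.span {((G.presheaf.stalkCongr (.of_eq (rfl : υ y' = υ y'))).inv ≫ υ.stalkMap y').hom (cb 0)} := by rw [← hEup 1 χ hχ, hEdown 0 χ' hχ']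
      have hnzd : ((G.presheaf.stalkCongr (.of_eq (rfl : υ y' = υ y'))).inv ≫ υ.stalkMap y').hom (cb 1) ∈ nonZeroDivisors _ := mem_nonZeroDivisors_of_stalkIdeal_comap_eq_span hυ y' (hEup 1 χ hχ)
      have hunit := isUnit_of_mul_eq_of_span_singleton_eq (hfrac_up 1 0 χ hχ) hspan hnzd
      exact Ideal.eq_top_of_isUnit_mem _ (Ideal.mem_sup_right (Ideal.mem_span_singleton_self _)) hunit
    · -- charts `(m, m̄)`: the fractions agree
      rw [(stalkIdeal_directionCentre_of_chart_one hτ 𝒟 (j' y') hyx c hc h𝒟 χ hχ).2,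
        (stalkIdeal_directionCentre_of_chart_one hυ (𝒟.comap j) y' rfl cb hcbI hcb𝒟 χ' hχ').2, Ideal.map_sup, Ideal.map_span,
        Ideal.map_span, Set.image_singleton, Set.image_singleton, ha]
      have hnzd : ((G.presheaf.stalkCongr (.of_eq (rfl : υ y' = υ y'))).inv ≫ υ.stalkMap y').hom (cb 1) ∈ nonZeroDivisors _ := mem_nonZeroDivisors_of_stalkIdeal_comap_eq_span hυ y' (hEup 1 χ hχ)
      have hq : (j'.stalkMap y').hom (χ (blowupAlgebra.frac c 1 0)) = χ' (blowupAlgebra.frac cb 1 0) := by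
        have h : ((j'.stalkMap y').hom (χ (blowupAlgebra.frac c 1 0)) - χ' (blowupAlgebra.frac cb 1 0)) * ((G.presheaf.stalkCongr (.of_eq (rfl : υ y' = υ y'))).inv ≫ υ.stalkMap y').hom (cb 1) = 0 := by
          rw [sub_mul, hfrac_up 1 0 χ hχ, hfrac_down 1 0 χ' hχ', sub_self]
        exact sub_eq_zero.mp ((mem_nonZeroDivisors_iff_right.mp hnzd) _ h)
      rw [hq]
  · -- off `V(Ī)`: both stalks contain `𝒟̄·𝒪 = ⊤`
    have hx : τ (j' y') ∉ I.support := by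
      rw [hyx]
      intro h
      apply hz
      have h' : υ y' ∈ ((I.comap j).support : Set G) := by
        rw [Scheme.IdealSheafData.support_comap]; exact h
      exact h'
    have h𝒟top : stalkIdeal 𝒟 (τ (j' y')) = ⊤ := by
      refine top_le_iff.mp ?_
      have h := stalkIdeal_mono hI𝒟 (τ (j' y'))
      rw [stalkIdeal_mul, stalkIdeal_eq_top_of_not_mem_support hx, Ideal.top_mul] at h
      exact h
    have hup : stalkIdeal (controlledTransform τ I 𝒟 1) (j' y') = ⊤ := by
      refine top_le_iff.mp ?_
      have h := stalkIdeal_mono (comap_le_controlledTransform τ I 𝒟 1) (j' y')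
      rw [stalkIdeal_comap_eq_map_stalkMap, h𝒟top, Ideal.map_top] at h
      exact h
    have hdown : stalkIdeal (controlledTransform υ (I.comap j) (𝒟.comap j) 1) y' = ⊤ := by
      refine top_le_iff.mp ?_
      have h := stalkIdeal_mono (comap_le_controlledTransform υ (I.comap j) (𝒟.comap j) 1) y'
      rw [← Scheme.IdealSheafData.comap_comp, ← hcomm, Scheme.IdealSheafData.comap_comp, stalkIdeal_comap_eq_map_stalkMap,
        stalkIdeal_comap_eq_map_stalkMap, h𝒟top, Ideal.map_top, Ideal.map_top] at h
      exact h
    rw [hup, hdown, Ideal.map_top]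

end Summit.ResolutionOfSingularities.ResolutionOfSingularities.Cruxes.EquisingularLiftNat.Sections

end
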